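import Summits.Schanuel.Schanuel.Theorems.RootDecomp1KGeneric02

/-!
# GaugeResidual — writer-1 g12 kernel note on the typed level-3 residual of lens-6's GENERIC CELLS node

The typed residual `Rank3HyperResidual` (tree: `RootDecomp1KGeneric02`, §5) cuts the level-3 storey of
A₄ʰ by the COORDINATE predicate `HasHLRatio z` («two coordinates of `z` are proportional by a
hyper-Liouville real»).  The three other data of the storey — ℚ-freeness, `HyperLinLiouville`, and the
conclusion `SB 3` — are invariant under re-basing the tuple by `GL₃(ℤ)` (up to the harmless `m ↦ 2m`
in the exponent scale), but `HasHLRatio` is not.  Consequence, certified below WITHOUT any transcendence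
input (no NW96, no KS, no CF): the shear `(u, ρu, w) ↦ (u + w, ρu, w)` carries every line cell whose
third coordinate is not a REAL multiple of the anchor into the typed residual, and the Schanuel field only
shrinks, so `Rank3HyperResidual` ALONE already decides all those line cells
(`rank3HyperResidual_decides_nonreal_lineCells`).  The typed residual is therefore not «the storey minus
the line cells» but (up to gauge) cofinal with the generic part of the storey; the honest, gauge-invariant
residual quantifies over the ℤ-SPAN: «`span_ℤ(z)` contains no line pair `{v, ρv}`»
(`Rank3SpanResidual`, with the corrected exactness `level3_iff_rank3Span`, mod NW + KS + CF as before).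
Scratch certificate (writer folder), not a tree file; sorry-free.
-/


noncomputable section

open Complex IntermediateField

namespace Summit.Schanuel.Schanuel.Theorems.RootDecomp1KGeneric

open Summit.Schanuel.Schanuel.Theorems.RootDecomp1KHyper (SB SFset mem_adjoin_SFset_I' one_le_hsum
  hsum_nonneg abs_le_hsum)
open Summit.Schanuel.Schanuel.Theorems.RootDecomp1KHyper.HyperCell (HyperLiouville HyperLinLiouville
  HyperLiouville.ne_zero HyperLiouville.ne_ratCast hyperLinLiouville_of_prefix
  hyperLinLiouville_of_hyperLiouville_ratio)
open Literature.NumberTheory.Transcendental (NesterenkoWaldschmidt1996_thm_1)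

/-! ## 1. The shear `(a, b, c) ↦ (a + c, b, c)` preserves the three invariant data -/

/-- ℚ-freeness is invariant under the shear. -/
theorem linearIndependent_shear {a b c : ℂ} (h : LinearIndependent ℚ ![a, b, c]) :
    LinearIndependent ℚ ![a + c, b, c] := by
  rw [Fintype.linearIndependent_iff] at h ⊢
  intro g hg
  have hg' : ∑ i, (![g 0, g 1, g 0 + g 2] : Fin 3 → ℚ) i • (![a, b, c] : Fin 3 → ℂ) i = 0 := by
    simp only [Fin.sum_univ_three, Matrix.cons_val_zero, Matrix.cons_val_one, Matrix.head_cons,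
      Matrix.cons_val_two, Matrix.tail_cons] at hg ⊢
    rw [← hg]
    simp only [add_smul, smul_add]
    abel
  have h0 := h _ hg' 0
  have h1 := h _ hg' 1
  have h2 := h _ hg' 2
  simp only [Matrix.cons_val_zero, Matrix.cons_val_one, Matrix.head_cons, Matrix.cons_val_two,
    Matrix.tail_cons] at h0 h1 h2
  intro i
  fin_cases i
  · exact h0
  · exact h1
  · simpa [h0] using h2

/-- `HyperLinLiouville` is invariant under the shear (re-index the small forms by the transpose-inverse
and absorb the height loss `S' ≤ 2S ≤ S²` into `m ↦ 2m`). -/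
theorem hyperLinLiouville_shear {a b c : ℂ} (hz : HyperLinLiouville ![a, b, c]) :
    HyperLinLiouville ![a + c, b, c] := by
  intro m
  obtain ⟨h, hh, hlt⟩ := hz (2 * m)
  refine ⟨![h 0, h 1, h 2 - h 0], ?_, ?_⟩
  · intro h0
    apply hh
    have e0 := congr_fun h0 0
    have e1 := congr_fun h0 1
    have e2 := congr_fun h0 2
    simp only [Matrix.cons_val_zero, Matrix.cons_val_one, Matrix.head_cons, Matrix.cons_val_two,
      Matrix.tail_cons, Pi.zero_apply] at e0 e1 e2
    have e2' : h 2 = 0 := by rw [sub_eq_zero] at e2; rw [e2, e0]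
    funext i
    fin_cases i
    · exact e0
    · exact e1
    · exact e2'
  · have hsum : ∑ i, ((![h 0, h 1, h 2 - h 0] : Fin 3 → ℤ) i : ℂ) * (![a + c, b, c] : Fin 3 → ℂ) i =
        ∑ i, (h i : ℂ) * (![a, b, c] : Fin 3 → ℂ) i := by
      simp only [Fin.sum_univ_three, Matrix.cons_val_zero, Matrix.cons_val_one, Matrix.head_cons,
        Matrix.cons_val_two, Matrix.tail_cons]
      push_cast
      ring
    rw [hsum]
    refine hlt.trans_le (Real.exp_le_exp.mpr (neg_le_neg ?_))
    -- height bookkeeping: S' ≤ 2 S ≤ S * S, so S'^m ≤ (S*S)^m = S^(2m)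
    set S : ℝ := 1 + ∑ i, (|h i| : ℝ) with hS
    have hS2 : 2 ≤ S := by linarith [one_le_hsum hh]
    have hS' : 1 + ∑ i, (|(![h 0, h 1, h 2 - h 0] : Fin 3 → ℤ) i| : ℝ) ≤ 2 * S := by
      simp only [Fin.sum_univ_three, Matrix.cons_val_zero, Matrix.cons_val_one, Matrix.head_cons,
        Matrix.cons_val_two, Matrix.tail_cons] at hS ⊢
      rw [hS]
      push_cast
      have := abs_sub (h 2 : ℝ) (h 0 : ℝ)
      linarith [abs_nonneg (h 0 : ℝ), abs_nonneg (h 1 : ℝ), abs_nonneg (h 2 : ℝ)]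
    have hnn : 0 ≤ 1 + ∑ i, (|(![h 0, h 1, h 2 - h 0] : Fin 3 → ℤ) i| : ℝ) := by
      linarith [hsum_nonneg (![h 0, h 1, h 2 - h 0] : Fin 3 → ℤ)]
    calc (1 + ∑ i, (|(![h 0, h 1, h 2 - h 0] : Fin 3 → ℤ) i| : ℝ)) ^ m
        ≤ (2 * S) ^ m := pow_le_pow_left₀ hnn hS' m
      _ ≤ (S * S) ^ m := pow_le_pow_left₀ (by linarith) (by nlinarith) m
      _ = S ^ (2 * m) := by rw [← sq, ← pow_mul]

/-- The Schanuel field only SHRINKS under the shear (`e^{a+c} = e^a e^c`), so `SB 3` transfers back. -/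
theorem adjoin_SFset_shear_le (a b c : ℂ) :
    adjoin ℚ (SFset ![a + c, b, c]) ≤ adjoin ℚ (SFset ![a, b, c]) := by
  refine adjoin_le_iff.mpr ?_
  have ha : a ∈ adjoin ℚ (SFset ![a, b, c]) := subset_adjoin ℚ _ (Or.inl ⟨0, rfl⟩)
  have hb : b ∈ adjoin ℚ (SFset ![a, b, c]) := subset_adjoin ℚ _ (Or.inl ⟨1, rfl⟩)
  have hc : c ∈ adjoin ℚ (SFset ![a, b, c]) := subset_adjoin ℚ _ (Or.inl ⟨2, rfl⟩)
  have hea : cexp a ∈ adjoin ℚ (SFset ![a, b, c]) := subset_adjoin ℚ _ (Or.inr ⟨0, rfl⟩)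
  have heb : cexp b ∈ adjoin ℚ (SFset ![a, b, c]) := subset_adjoin ℚ _ (Or.inr ⟨1, rfl⟩)
  have hec : cexp c ∈ adjoin ℚ (SFset ![a, b, c]) := subset_adjoin ℚ _ (Or.inr ⟨2, rfl⟩)
  rintro x (⟨i, rfl⟩ | ⟨i, rfl⟩)
  · fin_cases i
    · exact add_mem ha hc
    · exact hb
    · exact hc
  · fin_cases i
    · show cexp (a + c) ∈ _
      rw [Complex.exp_add]; exact mul_mem hea hec
    · exact heb
    · exact hec

/-- Schanuel's bound transfers back along the shear `(a + c, b, c) ↦ (a, b, c)` (same field). -/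
theorem sb_of_sb_shear {a b c : ℂ} (h : SB 3 ![a + c, b, c]) : SB 3 ![a, b, c] :=
  h.trans (trdeg_le_of_injective (IntermediateField.inclusion (adjoin_SFset_shear_le a b c))
    (IntermediateField.inclusion_injective _))

/-! ## 2. The sheared line cell has NO hyper-Liouville coordinate ratio -/

/-- For `u ≠ 0`, `ρ ≠ 0` and `w ∉ ℝ·u`, the triple `(u + w, ρu, w)` has no two coordinates proportional
by a hyper-Liouville (indeed by any irrational, non-`1`) real. -/
theorem not_hasHLRatio_shear {u w : ℂ} {ρ : ℝ} (hu : u ≠ 0) (hρ0 : ρ ≠ 0)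
    (hw : ∀ t : ℝ, w ≠ (t : ℂ) * u) : ¬ HasHLRatio ![u + w, (ρ : ℂ) * u, w] := by
  rintro ⟨i, j, σ, hσ, hij⟩
  have hσ0 : σ ≠ 0 := HyperLiouville.ne_zero hσ
  have hσ1 : σ ≠ 1 := by have := HyperLiouville.ne_ratCast hσ 1; simpa using this
  have hσ0' : (σ : ℂ) ≠ 0 := Complex.ofReal_ne_zero.mpr hσ0
  have hσ1' : (σ : ℂ) - 1 ≠ 0 := sub_ne_zero.mpr (by exact_mod_cast hσ1)
  have h1σ' : (1 : ℂ) - σ ≠ 0 := sub_ne_zero.mpr (by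
    intro h; exact hσ1 (by exact_mod_cast h.symm))
  have hρ0' : (ρ : ℂ) ≠ 0 := Complex.ofReal_ne_zero.mpr hρ0
  have hw0 : w ≠ 0 := fun h => hw 0 (by simp [h])
  fin_cases i <;> fin_cases j <;>
    simp only [Matrix.cons_val_zero, Matrix.cons_val_one, Matrix.head_cons, Matrix.cons_val_two,
      Matrix.tail_cons, Fin.zero_eta, Fin.mk_one, Fin.reduceFinMk] at hij
  · -- (0,0): u + w = σ (u + w)
    have : u + w = 0 := by
      have e : ((σ : ℂ) - 1) * (u + w) = 0 := by linear_combination -hij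
      exact (mul_eq_zero.mp e).resolve_left hσ1'
    exact hw (-1) (by push_cast; linear_combination this)
  · -- (0,1): ρ u = σ (u + w)
    refine hw (ρ / σ - 1) ?_
    push_cast
    field_simp
    linear_combination -hij
  · -- (0,2): w = σ (u + w)
    refine hw (σ / (1 - σ)) ?_
    push_cast
    field_simp
    linear_combination hij
  · -- (1,0): u + w = σ ρ u
    exact hw (σ * ρ - 1) (by push_cast; linear_combination hij)
  · -- (1,1): ρ u = σ ρ u
    have e : ((σ : ℂ) - 1) * ((ρ : ℂ) * u) = 0 := by linear_combination -hij
    rcases mul_eq_zero.mp e with h | h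
    · exact hσ1' h
    · exact (mul_ne_zero hρ0' hu) h
  · -- (1,2): w = σ ρ u
    exact hw (σ * ρ) (by push_cast; linear_combination hij)
  · -- (2,0): u + w = σ w
    refine hw (1 / (σ - 1)) ?_
    push_cast
    field_simp
    linear_combination -hij
  · -- (2,1): ρ u = σ w
    refine hw (ρ / σ) ?_
    push_cast
    field_simp
    linear_combination -hij
  · -- (2,2): w = σ w
    have e : ((σ : ℂ) - 1) * w = 0 := by linear_combination -hij
    rcases mul_eq_zero.mp e with h | h
    · exact hσ1' h
    · exact hw0 h

/-! ## 3. The certificate: the typed residual ALONE decides the non-real line cells -/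

/-- A line cell `(u, ρu, w)` is automatically `HyperLinLiouville` (prefix `(u, ρu)`). -/
theorem hyperLinLiouville_lineCell {u : ℂ} {ρ : ℝ} (hρ : HyperLiouville ρ) (w : ℂ) :
    HyperLinLiouville ![u, (ρ : ℂ) * u, w] := by
  refine hyperLinLiouville_of_prefix (k := 2) (by omega) ?_
  have h2 : (fun i : Fin 2 => (![u, (ρ : ℂ) * u, w] : Fin 3 → ℂ)
      (Fin.castLE (show 2 ≤ 3 by omega) i)) = ![u, (ρ : ℂ) * u] := by
    funext i; fin_cases i <;> rfl
  rw [h2]; exact hyperLinLiouville_of_hyperLiouville_ratio hρ u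

/-- **GAUGE DEFECT of the typed residual (kernel, hypothesis-free).**  `Rank3HyperResidual` — with NO
transcendence input (no NW96 Thm 1, no `KummerSpecialisation`, no `CylinderFunnel(Weak)`) — already gives
Schanuel's bound on every ℚ-free line cell `(u, ρu, w)` of A₄ʰ whose third coordinate is not a real multiple
of the anchor: the sheared tuple `(u + w, ρu, w)` is ℚ-free, hyper-Liouville, has no hyper-Liouville
coordinate ratio, and generates a SMALLER Schanuel field.  So the «residual» is cofinal (up to `GL₃(ℤ)`)
with the generic cells it was meant to exclude. -/
theorem rank3HyperResidual_decides_nonreal_lineCells (hR : Rank3HyperResidual) {u w : ℂ} {ρ : ℝ}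
    (hρ : HyperLiouville ρ) (hw : ∀ t : ℝ, w ≠ (t : ℂ) * u)
    (hli : LinearIndependent ℚ ![u, (ρ : ℂ) * u, w]) : SB 3 ![u, (ρ : ℂ) * u, w] :=
  sb_of_sb_shear (hR _ (linearIndependent_shear hli)
    (hyperLinLiouville_shear (hyperLinLiouville_lineCell hρ w))
    (not_hasHLRatio_shear (hli.ne_zero 0) (HyperLiouville.ne_zero hρ) hw))


/-! ## 4. The gauge-invariant re-typing: no line pair in the ℤ-span -/

/-- `span_ℤ(z)` contains a LINE PAIR: some `v ≠ 0` together with `ρv`, `ρ` hyper-Liouville.  This depends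
only on the lattice `span_ℤ(z)`, hence is invariant under `GL_n(ℤ)` re-basing of the tuple (and, clearing
denominators, under `GL_n(ℚ)`). -/
def HasHLPairInSpan {n : ℕ} (z : Fin n → ℂ) : Prop :=
  ∃ (v : ℂ) (ρ : ℝ), v ≠ 0 ∧ HyperLiouville ρ ∧ v ∈ Submodule.span ℤ (Set.range z) ∧
    (ρ : ℂ) * v ∈ Submodule.span ℤ (Set.range z)

/-- A coordinate hyper-Liouville ratio is a line pair in the span. -/
theorem hasHLPairInSpan_of_hasHLRatio {n : ℕ} {z : Fin n → ℂ} (hz : LinearIndependent ℚ z)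
    (h : HasHLRatio z) : HasHLPairInSpan z := by
  obtain ⟨i, j, ρ, hρ, hij⟩ := h
  exact ⟨z i, ρ, hz.ne_zero i, hρ, Submodule.subset_span ⟨i, rfl⟩,
    hij ▸ Submodule.subset_span ⟨j, rfl⟩⟩

/-- Elements of the ℤ-span lie in the Schanuel field `ℚ(z, e^z, i)` … -/
theorem mem_adjoin_of_mem_span {N : ℕ} {z : Fin N → ℂ} {v : ℂ}
    (hv : v ∈ Submodule.span ℤ (Set.range z)) : v ∈ adjoin ℚ (SFset z ∪ {I}) := by
  induction hv using Submodule.span_induction with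
  | mem x hx => exact mem_adjoin_SFset_I' (Or.inl hx)
  | zero => exact zero_mem _
  | add x y _ _ hx hy => exact add_mem hx hy
  | smul a x _ hx => exact zsmul_mem hx a

/-- … and so do their exponentials (`e^{Σ aᵢ zᵢ} = Π (e^{zᵢ})^{aᵢ}`, `aᵢ ∈ ℤ`). -/
theorem cexp_mem_adjoin_of_mem_span {N : ℕ} {z : Fin N → ℂ} {v : ℂ}
    (hv : v ∈ Submodule.span ℤ (Set.range z)) : cexp v ∈ adjoin ℚ (SFset z ∪ {I}) := by
  induction hv using Submodule.span_induction with
  | mem x hx =>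
    obtain ⟨i, rfl⟩ := hx
    exact mem_adjoin_SFset_I' (Or.inr ⟨i, rfl⟩)
  | zero => rw [Complex.exp_zero]; exact one_mem _
  | add x y _ _ hx hy => rw [Complex.exp_add]; exact mul_mem hx hy
  | smul a x _ hx => rw [zsmul_eq_mul, Complex.exp_int_mul]; exact zpow_mem hx a

/-- **The honest generic cell (mod NW + KS + CF)**: a line pair ANYWHERE in `span_ℤ(z)` gives `SB 3 z`. -/
theorem sb_three_of_hlPairInSpan (hNW : NesterenkoWaldschmidt1996_thm_1) (hKS : KummerSpecialisation)
    (hCF : CylinderFunnelWeak) {z : Fin 3 → ℂ} (h : HasHLPairInSpan z) : SB 3 z := by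
  obtain ⟨v, ρ, hv0, hρ, hv, hρv⟩ := h
  exact sb_generic_of_mem4 hNW hKS hCF hv0 hρ le_rfl (mem_adjoin_of_mem_span hv)
    (mem_adjoin_of_mem_span hρv) (cexp_mem_adjoin_of_mem_span hρv) (cexp_mem_adjoin_of_mem_span hv)

/-- **The SPAN RESIDUAL** — proposed gauge-invariant re-typing of the level-3 residual: ℚ-free hyper-Liouville
triples whose ℤ-span contains NO line pair have Schanuel's bound. -/
def Rank3SpanResidual : Prop :=
  ∀ z : Fin 3 → ℂ, LinearIndependent ℚ z → HyperLinLiouville z → ¬ HasHLPairInSpan z → SB 3 z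

/-- The span residual is implied by the typed one (it quantifies over FEWER tuples) … -/
theorem rank3SpanResidual_of_rank3HyperResidual (hR : Rank3HyperResidual) : Rank3SpanResidual :=
  fun z hz hH hn => hR z hz hH fun hr => hn (hasHLPairInSpan_of_hasHLRatio hz hr)

/-- … and still carries the level-3 storey: **corrected EXACTNESS** (mod NW + KS + CF). -/
theorem level3_iff_rank3Span (hNW : NesterenkoWaldschmidt1996_thm_1) (hKS : KummerSpecialisation)
    (hCF : CylinderFunnelWeak) :
    (∀ z : Fin 3 → ℂ, LinearIndependent ℚ z → HyperLinLiouville z → SB 3 z) ↔ Rank3SpanResidual :=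
  ⟨fun h z hz hH _ => h z hz hH, fun hR z hz hH => by
    by_cases hp : HasHLPairInSpan z
    · exact sb_three_of_hlPairInSpan hNW hKS hCF hp
    · exact hR z hz hH hp⟩

/-- So the typed and the span residual are EQUIVALENT mod NW + KS + CF (the difference is invisible to the
assembly) — but only the span residual excludes the sheared line cells: -/
theorem rank3HyperResidual_iff_rank3Span (hNW : NesterenkoWaldschmidt1996_thm_1)
    (hKS : KummerSpecialisation) (hCF : CylinderFunnelWeak) :
    Rank3HyperResidual ↔ Rank3SpanResidual :=
  ⟨rank3SpanResidual_of_rank3HyperResidual, fun h =>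
    (level3_iff_rank3 hNW hKS hCF).mp ((level3_iff_rank3Span hNW hKS hCF).mpr h)⟩

/-- The lattice is unchanged by the shear … -/
theorem span_shear (a b c : ℂ) :
    Submodule.span ℤ (Set.range ![a + c, b, c]) = Submodule.span ℤ (Set.range ![a, b, c]) := by
  apply le_antisymm
  · refine Submodule.span_le.mpr ?_
    rintro x ⟨i, rfl⟩
    fin_cases i
    · exact add_mem (Submodule.subset_span ⟨0, rfl⟩) (Submodule.subset_span ⟨2, rfl⟩)
    · exact Submodule.subset_span ⟨1, rfl⟩
    · exact Submodule.subset_span ⟨2, rfl⟩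
  · refine Submodule.span_le.mpr ?_
    rintro x ⟨i, rfl⟩
    fin_cases i
    · have h0 : a + c ∈ Submodule.span ℤ (Set.range ![a + c, b, c]) := Submodule.subset_span ⟨0, rfl⟩
      have h2 : c ∈ Submodule.span ℤ (Set.range ![a + c, b, c]) := Submodule.subset_span ⟨2, rfl⟩
      simpa using sub_mem h0 h2
    · exact Submodule.subset_span ⟨1, rfl⟩
    · exact Submodule.subset_span ⟨2, rfl⟩

/-- … hence so is the span predicate, … -/
theorem hasHLPairInSpan_shear_iff (a b c : ℂ) :
    HasHLPairInSpan ![a + c, b, c] ↔ HasHLPairInSpan ![a, b, c] := by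
  unfold HasHLPairInSpan
  rw [span_shear]

/-- … and the sheared line cells `(u + w, ρu, w)` — inside the TYPED residual by §2 — are OUTSIDE the span
residual, as they should be. -/
theorem hasHLPairInSpan_shear_lineCell {u : ℂ} (hu : u ≠ 0) {ρ : ℝ} (hρ : HyperLiouville ρ) (w : ℂ) :
    HasHLPairInSpan ![u + w, (ρ : ℂ) * u, w] :=
  (hasHLPairInSpan_shear_iff u _ w).mpr
    ⟨u, ρ, hu, hρ, Submodule.subset_span ⟨0, rfl⟩, Submodule.subset_span ⟨1, rfl⟩⟩

end Summit.Schanuel.Schanuel.Theorems.RootDecomp1KGeneric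

end
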